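import Literature.Geometry.Lorentzian.BoundaryGeodesicAgreement
import Literature.Geometry.Lorentzian.SubdevelopmentCausalConvexity
import HarnessLib

/-!
# Radial geodesics of a common development and the two-point inverse of the exponential map
# (preparations for Sbierski 2016, §3.2, Lemma 14 "ExtendIso")

J. Sbierski, *On the existence of a maximal Cauchy development for the Einstein equations: a
dezornification*, Ann. Henri Poincaré 17 (2016) 301–329 = arXiv:1309.7591v3, §3.2, Lemma 14:
the isometric embedding `ψ` of a common globally hyperbolic development `U ⊆ M` into `M'`
extends smoothly across a pair `(p, p')` of corresponding boundary points by
`ψ̂ = exp_{γ'(-ε)} ∘ ψ_* ∘ exp⁻¹_{γ(-ε)}` for a timelike geodesic `γ` of `U` approaching `p`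
(*"This is clearly a smooth diffeomorphism onto its image and it also agrees with `ψ` on
`W ∩ U`, since the exponential map commutes with isometries"*). This file supplies the four
geometric ingredients of that construction over the tree's uniformly normal neighbourhoods
(`exists_twoPoint_expInverse`, `TwoPointExpInverse.lean`) in place of convex ones; the extension
itself is `CorrespondingBoundaryExtension.lean`.

* `twoPoint_expInverse_eq_of_tendsto_radial` — **a radial geodesic `r ↦ exp_o (r v)` of a
  uniformly normal neighbourhood `W` which stays in `W` for `r ∈ [0, 1)` and converges to `z ∈ W`
  as `r ↑ 1` reaches `z`: `v ∈ 𝓔_o`, `exp_o v = z`, and `exp_o⁻¹ z = v`** (continuous induction on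
  `r` using the injectivity of `(q, ξ) ↦ (q, exp_q ξ)` on the open set `Src`); the step
  *"`γ'` is a timelike geodesic in `M'` with `lim γ' = p'` … `ψ_*[exp⁻¹(W)] ⊆ exp⁻¹(V')`"* of
  the printed proof;
* `injective_mfderiv_of_comp_eventuallyEq_id`, `injective_of_surjective_clm` — calculus: a local
  left inverse has surjective differential and the map injective differential (for
  `exp_o ∘ exp_o⁻¹ = id`);
* `LorentzianMetric.isTimelike_expInverse_of_curve` — **the radial vector `exp_o⁻¹` of the
  endpoint of a future timelike curve from `o` inside a normal neighbourhood is future timelike**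
  (O'Neill 1983, Lemma 5.33, from `eventually_isTimelike_expInverse_comp` and
  `radial_timecone_invariance`);
* `LorentzianMetric.radial_mem_opens_of_mem_closure` — **a radial future timelike geodesic from
  a point of `U` to a point of `Ū` runs in `U`** (causal convexity of the globally hyperbolic
  subregion `U`, `IsCauchyHypersurface.chronologicalFuture_inter_chronologicalPast_subset_opens`);
* `LorentzianMetric.expMap_smul_mfderiv_eq` — **`ψ` carries these radial geodesics to the radial
  geodesics of `M'` from `ψ o`**: `exp_{ψ o} (r dψ_o Z) = Ψ (exp_o (r Z))`
  (`IsIsometricImmersion.expMap_comp` on `(U, g|_U)` with `mem_expDomain_restrict_of_forall`).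

Everything is proved; no definitions, no named facts (D-0026).

## References

* J. Sbierski, Ann. Henri Poincaré 17 (2016) 301–329 = arXiv:1309.7591v3, §3.2, Lemma 14 and
  its proof (arXiv numbering). [Sbierski2016AHP]
* B. O'Neill, *Semi-Riemannian geometry with applications to relativity*, Academic Press 1983,
  Ch. 3, pp. 90–91 (isometries and `exp`); Ch. 5, Lemma 5.33, Prop. 5.34 (pp. 146–147).
  [ONeillSemiRiemannian1983]
* J. M. Lee, *Introduction to Riemannian Manifolds*, 2nd ed., GTM 176 (2018), Prop. 5.19 (e)
  (uniformly normal neighbourhoods). [LeeRiemannianManifolds2018]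
-/

noncomputable section

open Bundle Set Filter Function Metric TopologicalSpace Topology
open scoped Manifold ContDiff Topology

namespace Literature.Geometry.Lorentzian

open Literature.Geometry.Riemannian

/-! ### A radial geodesic of a uniformly normal neighbourhood which converges reaches its limit -/

section TwoPoint

variable {E : Type*} [NormedAddCommGroup E] [NormedSpace ℝ E] {H : Type*} [TopologicalSpace H]
  {I : ModelWithCorners ℝ E H} {M : Type*} [TopologicalSpace M] [ChartedSpace H M]
  [IsManifold I ∞ M] [FiniteDimensional ℝ E] [CompleteSpace E] [T2Space M] [I.Boundaryless]
  {cov : CovariantDerivative I E (TangentSpace I : M → Type _)}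
  [CovariantDerivative.ContMDiffCovariantDerivative cov 1]

/-- **A radial geodesic inside a uniformly normal neighbourhood which converges as `r ↑ 1` reaches
its limit at `r = 1`, and its initial velocity is the two-point inverse of the limit.** Let
`W ∋ c` be a uniformly normal neighbourhood with two-point inverse `Ξ` read through the
trivialisation `e` of `TM` at `c` (`exists_twoPoint_expInverse`: `(q, Ξ q z) ∈ Src` and
`exp_q (e⁻¹ (Ξ q z)) = z` for `q, z ∈ W`, the map `(q, ξ) ↦ (q, exp_q (e⁻¹ ξ))` being injective on
the open set `Src ⊇ W × {0}`). If `o ∈ W`, `v ∈ T_oM`, the radial geodesic `r ↦ exp_o (r v)` is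
defined and stays in `W` for `r ∈ [0, 1)`, and converges to `z ∈ W` as `r ↑ 1`, then
`Ξ o z = e v`, `v ∈ 𝓔_o` and `exp_o v = z`. (Continuous induction on `r`: the set of `r` with
`r • e v = Ξ o (exp_o (r v))` is closed, contains `0`, and is open by the injectivity on the open
set `Src`; then let `r ↑ 1`.) This is the step "`γ'` is a timelike geodesic in `M'` with
`lim γ' = p'` … `ψ_*(X) ∈ exp⁻¹_{γ'(-ε)}(V')`" of Sbierski 2016, §3.2, proof of Lemma 14, in a
uniformly normal (rather than convex) neighbourhood. [cite: Sbierski2016AHP, §3.2, proof of Lemma 14 (arXiv numbering)]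
[cite: LeeRiemannianManifolds2018, Prop. 5.19 (e)] -/
theorem twoPoint_expInverse_eq_of_tendsto_radial (c : M) {W : Set M} {Src : Set (M × E)}
    {Ξ : M → M → E} (hWo : IsOpen W) (hWsrc : W ⊆ (chartAt H c).source) (hSo : IsOpen Src)
    (hS0 : ∀ q ∈ W, (q, (0 : E)) ∈ Src)
    (hSdom : ∀ w ∈ Src, w.1 ∈ (chartAt H c).source ∧
      (trivializationAt E (TangentSpace I : M → Type _) c).symmL ℝ w.1 w.2 ∈ expDomain cov w.1)
    (hinjF : InjOn (fun w : M × E ↦ (w.1, expMap cov w.1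
      ((trivializationAt E (TangentSpace I : M → Type _) c).symmL ℝ w.1 w.2))) Src)
    (hΞ : ∀ q ∈ W, ∀ z ∈ W, (q, Ξ q z) ∈ Src ∧
      expMap cov q ((trivializationAt E (TangentSpace I : M → Type _) c).symmL ℝ q (Ξ q z)) = z)
    (hΞs : ContMDiffOn (I.prod I) 𝓘(ℝ, E) ∞ (uncurry Ξ) (W ×ˢ W))
    {o : M} (ho : o ∈ W) (v : TangentSpace I o)
    (hdom : ∀ r ∈ Ico (0 : ℝ) 1, r • v ∈ expDomain cov o)
    (hW : ∀ r ∈ Ico (0 : ℝ) 1, expMap cov o (r • v) ∈ W)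
    {z : M} (hz : z ∈ W) (hlim : Tendsto (fun r : ℝ ↦ expMap cov o (r • v)) (𝓝[<] 1) (𝓝 z)) :
    Ξ o z = (trivializationAt E (TangentSpace I : M → Type _) c).continuousLinearMapAt ℝ o v ∧
      (o, (trivializationAt E (TangentSpace I : M → Type _) c).continuousLinearMapAt ℝ o v) ∈ Src ∧
      v ∈ expDomain cov o ∧ expMap cov o v = z := by
  set e := trivializationAt E (TangentSpace I : M → Type _) c with he
  have hbase : e.baseSet = (chartAt H c).source := TangentBundle.trivializationAt_baseSet c
  have hoe : o ∈ e.baseSet := by rw [hbase]; exact hWsrc ho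
  set ξ : E := e.continuousLinearMapAt ℝ o v with hξ
  have hvξ : e.symmL ℝ o ξ = v := e.symmL_continuousLinearMapAt hoe v
  -- the radial geodesic and its continuity on `[0, 1)`
  set γ : ℝ → M := fun r ↦ expMap cov o (r • v) with hγ
  have hγc : ∀ r ∈ Ico (0 : ℝ) 1, ContinuousAt γ r := by
    intro r hr
    have hrD : r ∈ maximalGeodesicDomain cov o v :=
      (mem_maximalGeodesicDomain_iff_smul_mem_expDomain (cov := cov) o v r).2 (hdom r hr)
    exact (IsGeodesicOn.mdifferentiableAt_holds (isGeodesicOn_expMap_smul (cov := cov) o v)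
      hrD).continuousAt
  have hγ0 : γ 0 = o := by simp only [hγ, zero_smul]; exact expMap_zero (cov := cov) o
  -- `Ξ o o = 0`
  have hΞoo : Ξ o o = 0 := by
    have h1 : (o, Ξ o o) ∈ Src := (hΞ o ho o ho).1
    have h2 : (o, (0 : E)) ∈ Src := hS0 o ho
    have heq : (fun w : M × E ↦ (w.1, expMap cov w.1 (e.symmL ℝ w.1 w.2))) (o, Ξ o o) =
        (fun w : M × E ↦ (w.1, expMap cov w.1 (e.symmL ℝ w.1 w.2))) (o, (0 : E)) := by
      show (o, expMap cov o (e.symmL ℝ o (Ξ o o))) = (o, expMap cov o (e.symmL ℝ o 0))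
      rw [(hΞ o ho o ho).2, map_zero, expMap_zero (cov := cov) o]
    exact (Prod.ext_iff.1 (hinjF h1 h2 heq)).2
  -- continuity of `Ξ o ·` on `W`
  have hΞoc : ContinuousOn (fun z ↦ Ξ o z) W := by
    have h1 : Continuous (fun z : M ↦ (o, z)) := continuous_const.prodMk continuous_id
    exact hΞs.continuousOn.comp h1.continuousOn fun z hz ↦ ⟨ho, hz⟩
  -- KEY: `r • ξ = Ξ o (γ r)` for all `r ∈ [0, 1)`
  have hinj : ∀ r ∈ Ico (0 : ℝ) 1, (o, r • ξ) ∈ Src → r • ξ = Ξ o (γ r) := by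
    intro r hr hmem
    have h2 : (o, Ξ o (γ r)) ∈ Src := (hΞ o ho (γ r) (hW r hr)).1
    have heq : (fun w : M × E ↦ (w.1, expMap cov w.1 (e.symmL ℝ w.1 w.2))) (o, r • ξ) =
        (fun w : M × E ↦ (w.1, expMap cov w.1 (e.symmL ℝ w.1 w.2))) (o, Ξ o (γ r)) := by
      show (o, expMap cov o (e.symmL ℝ o (r • ξ))) = (o, expMap cov o (e.symmL ℝ o (Ξ o (γ r))))
      rw [(hΞ o ho (γ r) (hW r hr)).2, map_smul, hvξ]
    exact (Prod.ext_iff.1 (hinjF hmem h2 heq)).2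
  set s : Set ℝ := {r | (o, r • ξ) ∈ Src} with hs
  have hkey : ∀ r ∈ Ico (0 : ℝ) 1, r ∈ s := by
    intro r₁ hr₁
    -- continuous induction on `[0, r₁]`
    have hsub : Icc (0 : ℝ) r₁ ⊆ s := by
      refine IsClosed.Icc_subset_of_forall_mem_nhdsWithin ?_ ?_ ?_
      · -- `s ∩ [0, r₁]` is closed: on it `(o, r • ξ) = (o, Ξ o (γ r))`, a closed condition
        have hcont : ContinuousOn (fun r : ℝ ↦ (r • ξ, Ξ o (γ r))) (Icc (0 : ℝ) r₁) := by
          refine (continuous_id.smul continuous_const).continuousOn.prodMk ?_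
          intro r hr
          have hr' : r ∈ Ico (0 : ℝ) 1 := ⟨hr.1, hr.2.trans_lt hr₁.2⟩
          have h1 : ContinuousAt (fun r : ℝ ↦ Ξ o (γ r)) r :=
            ContinuousAt.comp (g := fun z ↦ Ξ o z) (f := γ)
              ((hΞoc _ (hW r hr')).continuousAt (hWo.mem_nhds (hW r hr'))) (hγc r hr')
          exact h1.continuousWithinAt
        have hcl : IsClosed {r ∈ Icc (0 : ℝ) r₁ | (fun r : ℝ ↦ (r • ξ, Ξ o (γ r))) r ∈
            (diagonal E)} :=
          hcont.preimage_isClosed_of_isClosed isClosed_Icc isClosed_diagonal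
        have heq : s ∩ Icc 0 r₁ = {r ∈ Icc (0 : ℝ) r₁ | (fun r : ℝ ↦ (r • ξ, Ξ o (γ r))) r ∈
            (diagonal E)} := by
          ext r
          simp only [mem_inter_iff, mem_setOf_eq, mem_diagonal_iff]
          constructor
          · rintro ⟨hrs, hr⟩
            exact ⟨hr, hinj r ⟨hr.1, hr.2.trans_lt hr₁.2⟩ hrs⟩
          · rintro ⟨hr, hreq⟩
            refine ⟨?_, hr⟩
            show (o, r • ξ) ∈ Src
            rw [hreq]
            exact (hΞ o ho (γ r) (hW r ⟨hr.1, hr.2.trans_lt hr₁.2⟩)).1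
        rw [heq]
        exact hcl
      · show (o, (0 : ℝ) • ξ) ∈ Src
        rw [zero_smul]
        exact hS0 o ho
      · rintro x ⟨hxs, hx⟩
        have hc : ContinuousAt (fun r : ℝ ↦ (o, r • ξ)) x :=
          (continuous_const.prodMk (continuous_id.smul continuous_const)).continuousAt
        exact nhdsWithin_le_nhds (hc.preimage_mem_nhds (hSo.mem_nhds hxs))
    exact hsub ⟨hr₁.1, le_rfl⟩
  have hrad : ∀ r ∈ Ico (0 : ℝ) 1, r • ξ = Ξ o (γ r) := fun r hr ↦ hinj r hr (hkey r hr)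
  -- let `r ↑ 1`
  have hlim1 : Tendsto (fun r : ℝ ↦ Ξ o (γ r)) (𝓝[<] 1) (𝓝 (Ξ o z)) :=
    Tendsto.comp (g := fun z ↦ Ξ o z) ((hΞoc z hz).continuousAt (hWo.mem_nhds hz)).tendsto hlim
  have hlim2 : Tendsto (fun r : ℝ ↦ r • ξ) (𝓝[<] 1) (𝓝 ξ) := by
    have h : Tendsto (fun r : ℝ ↦ r • ξ) (𝓝 1) (𝓝 ((1 : ℝ) • ξ)) :=
      (continuous_id.smul continuous_const).continuousAt
    rw [one_smul] at h
    exact h.mono_left nhdsWithin_le_nhds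
  have hev : (fun r : ℝ ↦ r • ξ) =ᶠ[𝓝[<] 1] fun r ↦ Ξ o (γ r) := by
    filter_upwards [Ico_mem_nhdsLT zero_lt_one] with r hr using hrad r hr
  have hξz : ξ = Ξ o z := tendsto_nhds_unique (hlim2.congr' hev) hlim1
  have hmem : (o, ξ) ∈ Src := by rw [hξz]; exact (hΞ o ho z hz).1
  refine ⟨hξz.symm, hmem, ?_, ?_⟩
  · have h := (hSdom _ hmem).2
    simp only at h
    rwa [hvξ] at h
  · have h := (hΞ o ho z hz).2
    rwa [← hξz, hvξ] at h

end TwoPoint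

/-! ### Calculus: one-sided inverses and the differential -/

section Calculus

variable {d : ℕ} {M : Type*} [TopologicalSpace M] [ChartedSpace (EuclideanSpace ℝ (Fin d)) M]
  [IsManifold (𝓡 d) ∞ M]

omit [IsManifold (𝓡 d) ∞ M] in
/-- **A map with a differentiable local left inverse has injective differential, and the left
inverse has surjective differential there** (chain rule applied to `F ∘ K = id` near `x`:
`dF_{K x} ∘ dK_x = id`). Used for the exponential map and its two-point inverse
(`exp_o ∘ exp_o⁻¹ = id`). [folklore] -/
theorem injective_mfderiv_of_comp_eventuallyEq_id {F : EuclideanSpace ℝ (Fin d) → M}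
    {K : M → EuclideanSpace ℝ (Fin d)} {x : M}
    (hK : MDifferentiableAt (𝓡 d) 𝓘(ℝ, EuclideanSpace ℝ (Fin d)) K x)
    (hF : MDifferentiableAt 𝓘(ℝ, EuclideanSpace ℝ (Fin d)) (𝓡 d) F (K x))
    (h : (F ∘ K) =ᶠ[𝓝 x] id) :
    Injective (mfderiv (𝓡 d) 𝓘(ℝ, EuclideanSpace ℝ (Fin d)) K x) ∧
      Surjective (mfderiv 𝓘(ℝ, EuclideanSpace ℝ (Fin d)) (𝓡 d) F (K x)) := by
  have hcomp : (mfderiv 𝓘(ℝ, EuclideanSpace ℝ (Fin d)) (𝓡 d) F (K x)).comp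
      (mfderiv (𝓡 d) 𝓘(ℝ, EuclideanSpace ℝ (Fin d)) K x) = ContinuousLinearMap.id ℝ _ := by
    rw [← mfderiv_comp x (g := F) (f := K) hF hK, h.mfderiv_eq, mfderiv_id]
  have hpt : ∀ v, mfderiv 𝓘(ℝ, EuclideanSpace ℝ (Fin d)) (𝓡 d) F (K x)
      (mfderiv (𝓡 d) 𝓘(ℝ, EuclideanSpace ℝ (Fin d)) K x v) = v := fun v ↦
    DFunLike.congr_fun hcomp v
  exact ⟨Function.LeftInverse.injective (g := mfderiv 𝓘(ℝ, EuclideanSpace ℝ (Fin d)) (𝓡 d) F (K x))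
    hpt, Function.RightInverse.surjective
      (g := mfderiv (𝓡 d) 𝓘(ℝ, EuclideanSpace ℝ (Fin d)) K x) hpt⟩

/-- An endomorphism of the model space which is surjective is injective (finite dimension).
[folklore] -/
theorem injective_of_surjective_clm
    {A : EuclideanSpace ℝ (Fin d) →L[ℝ] EuclideanSpace ℝ (Fin d)} (hA : Surjective A) :
    Injective A :=
  (LinearMap.injective_iff_surjective (f := (A : EuclideanSpace ℝ (Fin d) →ₗ[ℝ]
    EuclideanSpace ℝ (Fin d)))).2 hA

end Calculus

/-! ### Radial geodesics of a common development -/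

section Core

variable {d : ℕ} {M : Type*} [TopologicalSpace M] [ChartedSpace (EuclideanSpace ℝ (Fin d)) M]
  [IsManifold (𝓡 d) ∞ M] [T2Space M] [SecondCountableTopology M]
  {M' : Type*} [TopologicalSpace M'] [ChartedSpace (EuclideanSpace ℝ (Fin d)) M']
  [IsManifold (𝓡 d) ∞ M'] [T2Space M'] [SecondCountableTopology M']

namespace LorentzianMetric

variable {g : LorentzianMetric (𝓡 d) ∞ M} [g.HasLeviCivita]
  [CovariantDerivative.ContMDiffCovariantDerivative g.leviCivita 1] (τ : TimeOrientation g)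
  {g' : LorentzianMetric (𝓡 d) ∞ M'} [g'.HasLeviCivita]
  [CovariantDerivative.ContMDiffCovariantDerivative g'.leviCivita 1] (τ' : TimeOrientation g')

omit [SecondCountableTopology M] in
/-- **The radial vector of the endpoint of a future timelike curve in a normal neighbourhood is
future timelike** (O'Neill 1983, Ch. 5, Lemma 5.33, for differentiable curves): if `K` is a
smooth local inverse of `exp_o` on an open `V ∋ o` with `K o = 0` and `γ : [a, b] → V` is a future
timelike curve with `γ a = o`, then `K (γ b) = exp_o⁻¹ (γ b)` lies in the open future timecone of
`T_oM`: just after `a` this holds by `d(exp_o)_0 = id` (`eventually_isTimelike_expInverse_comp`),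
and the timecone is then never left (`radial_timecone_invariance`).
[cite: ONeillSemiRiemannian1983, Ch. 5, Lemma 5.33 (pp. 146–147)] -/
theorem isTimelike_expInverse_of_curve {o : M} {K : M → EuclideanSpace ℝ (Fin d)} {V : Set M}
    (hVo : IsOpen V) (hoV : o ∈ V) (hK : ContMDiffOn (𝓡 d) 𝓘(ℝ, EuclideanSpace ℝ (Fin d)) ∞ K V)
    (hKo : K o = 0)
    (hKexp : ∀ z ∈ V, expMap g.leviCivita o (K z : TangentSpace (𝓡 d) o) = z)
    (hKdom : ∀ z ∈ V, (K z : TangentSpace (𝓡 d) o) ∈ expDomain g.leviCivita o)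
    {γ : ℝ → M} {a b : ℝ} (hab : a < b) (hγ : g.IsFutureTimelikeCurveOn τ γ (Icc a b))
    (hγa : γ a = o) (hγV : ∀ t ∈ Icc a b, γ t ∈ V) :
    g.IsTimelike (x := o) (K (γ b)) ∧ τ.IsFutureDirected (x := o) (K (γ b)) := by
  haveI : Fact ((1 : ℕ∞ω) ≤ ∞) := ⟨by exact_mod_cast (le_top : (1 : ℕ∞) ≤ ⊤)⟩
  set cov := g.leviCivita with hcov
  have hKd : ∀ z ∈ V, MDifferentiableAt (𝓡 d) 𝓘(ℝ, (EuclideanSpace ℝ (Fin d))) K z := fun z hz ↦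
    (hK.contMDiffAt (hVo.mem_nhds hz)).mdifferentiableAt (by simp)
  -- just after `a`, `K ∘ γ` is in the open future timecone
  have hev := eventually_isTimelike_expInverse_comp τ (hVo.mem_nhds hoV) hK hKo hKexp hab hγ hγa
  obtain ⟨t₁, ht₁C, ht₁⟩ : ∃ t₁, (g.IsTimelike (x := o) (K (γ t₁)) ∧
      τ.IsFutureDirected (x := o) (K (γ t₁))) ∧ t₁ ∈ Ioo a b :=
    (hev.and (Ioo_mem_nhdsGT hab)).exists
  -- and it stays there up to `b`
  set β : ℝ → (EuclideanSpace ℝ (Fin d)) := fun t ↦ K (γ t) with hβ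
  have hsub : Icc t₁ b ⊆ Icc a b := Icc_subset_Icc ht₁.1.le le_rfl
  have hβd : ∀ t ∈ Icc t₁ b, HasDerivAt β (deriv β t) t := by
    intro t ht
    have h := (hKd _ (hγV t (hsub ht))).comp t (hγ t (hsub ht)).1
    exact (mdifferentiableAt_iff_differentiableAt.1 h).hasDerivAt
  have hβdom : ∀ t ∈ Icc t₁ b, (β t : TangentSpace (𝓡 d) o) ∈ expDomain cov o := fun t ht ↦
    hKdom _ (hγV t (hsub ht))
  have hβfut : ∀ t ∈ Icc t₁ b,
      τ.IsFutureDirected (velocity (𝓡 d) (fun s ↦ expMap cov o (β s : TangentSpace (𝓡 d) o)) t) := by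
    intro t ht
    have hcont : ContinuousAt γ t := (hγ t (hsub ht)).1.continuousAt
    have hev' : (fun s ↦ expMap cov o (β s : TangentSpace (𝓡 d) o)) =ᶠ[𝓝 t] γ := by
      filter_upwards [hcont.preimage_mem_nhds (hVo.mem_nhds (hγV t (hsub ht)))] with s hs
      exact hKexp (γ s) hs
    rw [velocity_congr_of_eventuallyEq (I := 𝓡 d) hev']
    convert (hγ t (hsub ht)).2.2 using 2
    exact hKexp (γ t) (hγV t (hsub ht))
  exact (radial_timecone_invariance τ le_rfl hβd hβdom hβfut ht₁C.1 ht₁C.2).1 b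
    (right_mem_Icc.2 ht₁.2.le)

/-- **A radial future timelike geodesic from a point of `U` to a point of `Ū` runs in `U`** (the
causal convexity of a globally hyperbolic subregion sharing the Cauchy hypersurface,
`IsCauchyHypersurface.chronologicalFuture_inter_chronologicalPast_subset_opens`; tacit in Sbierski
2016, §3.2, proof of Lemma 14: *"it also agrees with `ψ` on `W ∩ U`, since the exponential map
commutes with isometries"* needs the radial geodesic inside `U`). For `o ∈ U` and `Z ∈ 𝓔_o` future
timelike with `exp_o Z ∈ Ū`: `r Z ∈ 𝓔_o` for `r ∈ [0, 1]`, `r ↦ exp_o (r Z)` is a future timelike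
curve on `[0, 1]`, lies in `U` for `r ∈ [0, 1)`, and is continuous at `r = 1`.
[cite: Sbierski2016AHP, §3.2, proof of Lemma 14 (arXiv numbering)] -/
theorem radial_mem_opens_of_mem_closure (U : Opens M) {Sig : Set M}
    (hSig : g.IsCauchyHypersurface τ Sig)
    (hU : (g.restrict PseudoRiemannianMetric.contMDiff_restrict_holds U).IsCauchyHypersurface
      (τ.restrict PseudoRiemannianMetric.contMDiff_restrict_holds τ.contMDiff_restrict_holds U)
      (Subtype.val ⁻¹' Sig))
    {o : M} (hoU : o ∈ U) {Z : EuclideanSpace ℝ (Fin d)} (hZt : g.IsTimelike (x := o) Z)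
    (hZf : τ.IsFutureDirected (x := o) Z) (hZdom : (Z : TangentSpace (𝓡 d) o) ∈ expDomain g.leviCivita o)
    (hZcl : expMap g.leviCivita o (Z : TangentSpace (𝓡 d) o) ∈ closure (U : Set M)) :
    (∀ r ∈ Icc (0 : ℝ) 1,
        ((r • Z : EuclideanSpace ℝ (Fin d)) : TangentSpace (𝓡 d) o) ∈ expDomain g.leviCivita o) ∧
      g.IsFutureTimelikeCurveOn τ (fun r : ℝ ↦ expMap g.leviCivita o
        ((r • Z : EuclideanSpace ℝ (Fin d)) : TangentSpace (𝓡 d) o)) (Icc 0 1) ∧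
      (∀ r ∈ Ico (0 : ℝ) 1, expMap g.leviCivita o
        ((r • Z : EuclideanSpace ℝ (Fin d)) : TangentSpace (𝓡 d) o) ∈ U) ∧
      ContinuousAt (fun r : ℝ ↦ expMap g.leviCivita o
        ((r • Z : EuclideanSpace ℝ (Fin d)) : TangentSpace (𝓡 d) o)) 1 := by
  have hn2 : (2 : ℕ∞ω) ≤ ∞ := WithTop.coe_le_coe.mpr le_top
  haveI : Fact ((1 : ℕ∞ω) ≤ ∞) := ⟨le_trans one_le_two hn2⟩
  set cov := g.leviCivita with hcov
  set ρ : ℝ → M := fun r ↦ expMap cov o ((r • Z : EuclideanSpace ℝ (Fin d)) : TangentSpace (𝓡 d) o)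
    with hρ
  obtain ⟨hmax, h0D, -, -⟩ := maximalGeodesic_spec' (cov := cov) o (Z : TangentSpace (𝓡 d) o)
  have h1D : (1 : ℝ) ∈ maximalGeodesicDomain cov o (Z : TangentSpace (𝓡 d) o) := hZdom.2
  have hIccD : Icc (0 : ℝ) 1 ⊆ maximalGeodesicDomain cov o (Z : TangentSpace (𝓡 d) o) :=
    hmax.2.1.out h0D h1D
  have hrgeo : IsGeodesicOn cov ρ (maximalGeodesicDomain cov o (Z : TangentSpace (𝓡 d) o)) :=
    isGeodesicOn_expMap_smul (cov := cov) o (Z : TangentSpace (𝓡 d) o)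
  have hdomr : ∀ r ∈ Icc (0 : ℝ) 1,
      ((r • Z : EuclideanSpace ℝ (Fin d)) : TangentSpace (𝓡 d) o) ∈ expDomain cov o :=
    fun r hr ↦ (expMap_smul_of_mem (cov := cov) o (Z : TangentSpace (𝓡 d) o) (hIccD hr)).1
  have hrvel : ∀ θ ∈ maximalGeodesicDomain cov o (Z : TangentSpace (𝓡 d) o),
      g.IsTimelike (velocity (𝓡 d) ρ θ) ∧ τ.IsFutureDirected (velocity (𝓡 d) ρ θ) :=
    fun θ hθ ↦ isTimelike_isFutureDirected_velocity_expMap_smul τ hZt hZf hθ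
  have hcurve : ∀ θ₁ θ₂, 0 ≤ θ₁ → θ₂ ≤ 1 →
      g.IsFutureTimelikeCurveOn τ ρ (Icc θ₁ θ₂) := fun θ₁ θ₂ h1 h2 θ hθ ↦ by
    have hθD : θ ∈ maximalGeodesicDomain cov o (Z : TangentSpace (𝓡 d) o) :=
      hIccD ⟨h1.trans hθ.1, hθ.2.trans h2⟩
    exact ⟨IsGeodesicOn.mdifferentiableAt_holds hrgeo hθD, hrvel θ hθD⟩
  have hρ0 : ρ 0 = o := by simp only [hρ, zero_smul]; exact expMap_zero (cov := cov) o
  have hρ1 : ρ 1 = expMap cov o (Z : TangentSpace (𝓡 d) o) := by simp only [hρ, one_smul]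
  have hρU : ∀ θ ∈ Ico (0 : ℝ) 1, ρ θ ∈ U := by
    intro θ hθ
    rcases hθ.1.eq_or_lt with h0 | hθ0
    · rw [← h0, hρ0]; exact hoU
    refine hSig.chronologicalFuture_inter_chronologicalPast_subset_opens hn2 _ _ hU
      (q := o) (p := ρ 1) hoU (by rw [hρ1]; exact hZcl) ⟨?_, ?_⟩
    · exact ⟨o, rfl, ρ, 0, θ, hθ0, hcurve 0 θ le_rfl hθ.2.le, hρ0, rfl⟩
    · exact mem_chronologicalPast_of_mem_chronologicalFuture
        ⟨ρ θ, rfl, ρ, θ, 1, hθ.2, hcurve θ 1 hθ.1 le_rfl, rfl, rfl⟩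
  exact ⟨hdomr, hcurve 0 1 le_rfl le_rfl, hρU,
    (IsGeodesicOn.mdifferentiableAt_holds hrgeo h1D).continuousAt⟩

omit [SecondCountableTopology M] [SecondCountableTopology M'] in
/-- **`ψ` carries the radial geodesics of `U` from `o` to the radial geodesics of `M'` from
`ψ o`** (the exponential map commutes with isometric immersions, `IsIsometricImmersion.expMap_comp`,
applied to `(U, g|_U)`, whose exponential map is the restriction of that of `M`,
`mem_expDomain_restrict_of_forall`): if the radial geodesic `t ↦ exp_o (t Z)` lies in `U` for
`t ∈ [0, r]`, then `r dψ_o Z ∈ 𝓔_{ψ o}` and `exp_{ψ o} (r dψ_o Z) = Ψ (exp_o (r Z))` for any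
extension `Ψ` of `ψ`. Sbierski 2016, §3.2, proof of Lemma 14 ("`ψ(exp_{γ(-ε)}(X)) =
exp_{(ψ∘γ)(-ε)}(ψ_*(X))`"). [cite: Sbierski2016AHP, §3.2, proof of Lemma 14 (arXiv numbering)] -/
theorem expMap_smul_mfderiv_eq (U : Opens M)
    [(g.toPseudoRiemannianMetric.restrict PseudoRiemannianMetric.contMDiff_restrict_holds U).HasLeviCivita]
    [CovariantDerivative.ContMDiffCovariantDerivative
      (g.toPseudoRiemannianMetric.restrict PseudoRiemannianMetric.contMDiff_restrict_holds U).leviCivita 1]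
    {ψ : U → M'}
    (hψ : (g.restrict PseudoRiemannianMetric.contMDiff_restrict_holds U).IsIsometricImmersion
      g'.toPseudoRiemannianMetric ψ)
    {Ψ : M → M'} (hΨψ : ∀ (q : M) (hq : q ∈ U), Ψ q = ψ ⟨q, hq⟩) {o : M} (hoU : o ∈ U)
    {Z : EuclideanSpace ℝ (Fin d)}
    (hZdom : ∀ r ∈ Icc (0 : ℝ) 1,
      ((r • Z : EuclideanSpace ℝ (Fin d)) : TangentSpace (𝓡 d) o) ∈ expDomain g.leviCivita o)
    {r : ℝ} (hr : r ∈ Icc (0 : ℝ) 1)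
    (hrU : ∀ t ∈ Icc (0 : ℝ) r,
      expMap g.leviCivita o ((t • Z : EuclideanSpace ℝ (Fin d)) : TangentSpace (𝓡 d) o) ∈ U) :
    ((r • mfderiv (𝓡 d) (𝓡 d) ψ ⟨o, hoU⟩ Z : EuclideanSpace ℝ (Fin d)) :
        TangentSpace (𝓡 d) (ψ ⟨o, hoU⟩)) ∈ expDomain g'.leviCivita (ψ ⟨o, hoU⟩) ∧
      expMap g'.leviCivita (ψ ⟨o, hoU⟩) ((r • mfderiv (𝓡 d) (𝓡 d) ψ ⟨o, hoU⟩ Z :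
        EuclideanSpace ℝ (Fin d)) : TangentSpace (𝓡 d) (ψ ⟨o, hoU⟩)) =
        Ψ (expMap g.leviCivita o ((r • Z : EuclideanSpace ℝ (Fin d)) : TangentSpace (𝓡 d) o)) := by
  set gU := g.toPseudoRiemannianMetric.restrict PseudoRiemannianMetric.contMDiff_restrict_holds U
    with hgU
  have hψ' : gU.IsIsometricImmersion g'.toPseudoRiemannianMetric ψ := hψ
  have hmemU := PseudoRiemannianMetric.mem_expDomain_restrict_of_forall
    g.toPseudoRiemannianMetric U (y := ⟨o, hoU⟩)
    (v := ((r • Z : EuclideanSpace ℝ (Fin d)) : TangentSpace (𝓡 d) o)) (hZdom r hr) (fun t ht ↦ by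
      have h := hrU (t * r) ⟨mul_nonneg ht.1 hr.1, mul_le_of_le_one_left hr.1 ht.2⟩
      rw [← smul_smul] at h
      exact h)
  obtain ⟨hdom', hexp'⟩ := hψ'.expMap_comp rfl hmemU.1
  have hlin : ((r • mfderiv (𝓡 d) (𝓡 d) ψ ⟨o, hoU⟩ Z : EuclideanSpace ℝ (Fin d)) :
      TangentSpace (𝓡 d) (ψ ⟨o, hoU⟩)) =
      mfderiv (𝓡 d) (𝓡 d) ψ ⟨o, hoU⟩ ((r • Z : EuclideanSpace ℝ (Fin d)) : TangentSpace (𝓡 d) o) :=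
    (map_smul (mfderiv (𝓡 d) (𝓡 d) ψ ⟨o, hoU⟩) r Z).symm
  refine ⟨?_, ?_⟩
  · rw [hlin]
    exact hdom'
  · calc expMap g'.leviCivita (ψ ⟨o, hoU⟩) ((r • mfderiv (𝓡 d) (𝓡 d) ψ ⟨o, hoU⟩ Z :
          EuclideanSpace ℝ (Fin d)) : TangentSpace (𝓡 d) (ψ ⟨o, hoU⟩))
        = expMap g'.leviCivita (ψ ⟨o, hoU⟩) (mfderiv (𝓡 d) (𝓡 d) ψ ⟨o, hoU⟩
            ((r • Z : EuclideanSpace ℝ (Fin d)) : TangentSpace (𝓡 d) o)) := by rw [hlin]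
      _ = ψ (expMap gU.leviCivita ⟨o, hoU⟩
            ((r • Z : EuclideanSpace ℝ (Fin d)) : TangentSpace (𝓡 d) o)) := hexp'
      _ = ψ ⟨expMap g.leviCivita o ((r • Z : EuclideanSpace ℝ (Fin d)) : TangentSpace (𝓡 d) o),
            hrU r ⟨hr.1, le_rfl⟩⟩ := by
          congr 1
          exact Subtype.ext hmemU.2
      _ = Ψ (expMap g.leviCivita o ((r • Z : EuclideanSpace ℝ (Fin d)) : TangentSpace (𝓡 d) o)) :=
          (hΨψ _ _).symm

end LorentzianMetric

end Core

end Literature.Geometry.Lorentzian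

end
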